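import Literature.NumberTheory.Automorphic.QuaternionOrderHeckeJacquetLanglands
import Literature.NumberTheory.Automorphic.QuaternionOrderResidueStrongApproximation
import Literature.NumberTheory.EllipticCurves.GlobalMinimalModel
import HarnessLib

/-!
# Sketch (stub-critic `scrit-stub_jacquetVectorResidual-g0`): the MINIMAL print input for `stub_jacquetVectorResidual`,
typed over EXISTING Literature + Mathlib objects only (no `CoverReduction`, no `IndCuspForm`, no `spanG`, no port).

(JVᴸ) `cartanCover_unipotentFixed_in_span` — residue-model-bound idiom of
`Literature.NumberTheory.Automorphic.exists_reducedNorm_eq_one_map_eq_of_det_eq_one` (binders `S, hS, red, hsurj, hker, hdet`),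
cover order written out as in (JLᶜ) `jacquetLanglands_cartanCover_newform`.  Nothing is asserted; this file only checks that the
signature ELABORATES Literature-side.  See `STUB-PLAN-stub_jacquetVectorResidual.md` §2 (P0).
-/

noncomputable section

open scoped MatrixGroups ModularForm
open Literature.NumberTheory.Automorphic

namespace ScritSketch

/-- **(JVᴸ) UNIPOTENT-FIXED VECTOR IN THE COVER SPAN OF A CARTAN-LEVEL EIGENFORM AT A TAME CUBIC PLACE** (candidate named fact; D-0014 shape).
For a Cartan datum `X`, `q ∈ C` with `q ≡ 1 (3)`, an elliptic `V/ℚ` of conductor `N = D·M·∏_{p∈C} p²` with `q³ ∤ N` and `3 ∣ c_q(V)`, a non-zero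
`a_ℓ(V)`-eigenform `F₀ ∈ S₂(X.Γ)` (good `ℓ`), the cover order `O' = X.O + (∏_{C∖q} p)·X.O₀` (maximal at `q`) with norm-one group `Γ' = ι(O'¹)`, and ANY
residue model `red : O' → M₂(𝔽_q)` (surjective, kernel `qO'`, `det ∘ red = nrd mod q`): the `ℂ`-span of the slashes `F₀ ∣[2] γ`, `γ ∈ Γ'`, contains a
NON-ZERO function fixed by every `γ ∈ Γ'` whose residue is upper unipotent.  Print chain: JL (`π'_q ≅ π_{V,q}`, `q ∤ D`), local–global compatibility at
`q` for `V` (principal series `PS(μ₁ε₃, μ₂ε₃⁻¹)`), `K(q)`-type of a tame principal series `= Ind_B^G(ε̄₃ ⊠ ε̄₃⁻¹)` (which has `N(𝔽_q)`-fixed vectors),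
strong approximation for `O'¹`. -/
def cartanCover_unipotentFixed_in_span : Prop :=
  ∀ (D M : ℕ) (C : Finset ℕ) (X : CartanLevelCurveData D M C) (q : ℕ) [Fact q.Prime], q ∈ C → q % 3 = 1 →
    ∀ (hO' : Brandt.IsOrder X.B (X.O ⊔ X.O₀.map ((((∏ p ∈ C.erase q, p : ℕ) : ℤ)) • LinearMap.id)))
      (S : Subring X.B) (_hS : ∀ x : X.B, x ∈ S ↔ x ∈ X.O ⊔ X.O₀.map ((((∏ p ∈ C.erase q, p : ℕ) : ℤ)) • LinearMap.id))
      (red : S →+* Matrix (Fin 2) (Fin 2) (ZMod q)),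
      Function.Surjective red →
      (∀ x : S, red x = 0 ↔ ∃ y ∈ X.O ⊔ X.O₀.map ((((∏ p ∈ C.erase q, p : ℕ) : ℤ)) • LinearMap.id), (x : X.B) = (q : ℤ) • y) →
      (∀ x : S, ∃ n : ℤ, reducedNorm ℚ X.B (x : X.B) = n ∧ (red x).det = (n : ZMod q)) →
    ∀ (V : WeierstrassCurve ℚ) [V.IsElliptic] [V.IsGloballyMinimal] (N : ℕ),
      V.conductorNorm ℤ = N → D * M * ∏ p ∈ C, p ^ 2 = N → ¬ q ^ 3 ∣ N →
      3 ∣ (V.baseChange ℚ_[q]).localTamagawaNumber ℤ_[q] →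
    ∀ F₀ : CuspForm X.Gamma 2, (⇑F₀ : UpperHalfPlane → ℂ) ≠ 0 →
      (∀ ℓ : ℕ, ℓ.Prime → ¬ ℓ ∣ D * M * ∏ p ∈ C, p →
        X.heckeFun ℓ F₀ = fun τ => ((V.LFunction ℓ : ℤ) : ℂ) * F₀ τ) →
      ∃ G ∈ Submodule.span ℂ (Set.range fun γ : normOneUnits X.ι hO' =>
          (⇑F₀ : UpperHalfPlane → ℂ) ∣[(2 : ℤ)] ((γ : GL (Fin 2) ℝ))),
        G ≠ 0 ∧ ∀ (γ : normOneUnits X.ι hO') (x : S), X.ι (x : X.B) = ((γ : GL (Fin 2) ℝ) : Matrix (Fin 2) (Fin 2) ℝ) →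
          (red x) 0 0 = 1 → (red x) 1 0 = 0 → (red x) 1 1 = 1 →
          G ∣[(2 : ℤ)] ((γ : GL (Fin 2) ℝ)) = G

end ScritSketch

end
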